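import Summits.CriticalPhenomena.PercolationContinuityZ3.Theorems.PercNearOneGluingNoHeavyLowerTailSahiCTCC2Crossed
import Summits.CriticalPhenomena.PercolationContinuityZ3.Theorems.PercNearOneGluingNoHeavyLowerTailSahiCTCC2LevelTwo
import HarnessLib

/-!
# `NoHeavyLowerTail` (crux stmt-CriticalPhenomena-4575), P3 lane: the C2 difference in "`v`-FREE HARRIS" form —
# `P₂ − P₃ = GF(D¹)·H₁ + GF(D⁰∖D¹)·H_L + Π'·(cross) − Π'·(small common sets)` with `H₁ = H_D + H_L + ΔΔ` the middle slice of the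
# plain Harris form at `v` (its coefficients are Kleitman surpluses on sub-cubes with `v` FREE); at level `3` the subtracted block vanishes at every
# profile with `≥ 4` doubled points, so C2 holds there

Support file (seat `prim-l12-p3`, gen 43; `--supports stmt-CriticalPhenomena-4575`).  Memo
`run/shared/lean/prim/prim-l12/FROM-prim-l12-p3-g43-C2-LEVEL-THREE.md` §3.  Notation of `…SahiCTCC2Crossed` (`D⁰, D¹, X⁰, X¹, …` deletions / links at `v`,
`Π' = GF(delV v 2^α)`, `H_D = Π'·GF(X⁰∩Z⁰) − X⁰Z⁰`, `H_L = Π'·GF(X¹∩Z¹) − X¹Z¹`, `ΔΔ = (X¹−X⁰)(Z¹−Z⁰)`).  THIS FILE: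
* `RlumpVx_two_sub_three_eq_vfree` (ring identity, any `D, 𝒳, 𝒵`): the crossed form of `…C2Crossed` rewritten as
  `GF(D¹)·(H_D + H_L + ΔΔ) + (GF(D⁰) − GF(D¹))·H_L + Π'·(pq' + p'q) − Π'·(GF(D⁰)·GF(linkV (C∩D)) + GF(D¹)·GF(delV (C∩D)))` (`C = 𝒳∩𝒵`) — only the last
  block is negative, and it only involves the SMALL common sets;
* `coeff_harrisVfree_eq_kap` : `coeff_n (H_D + H_L + ΔΔ) = kap 𝒳 𝒵 (dbl n) (sgl n + v)` at `v`-free profiles `n ≤ 2` (the three pieces are the three terms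
  of the vertex recursion `…KleitmanSurplus.kap_rec` at `v`), hence `≥ 0` and MONOTONE under enlarging the free set;
* `coeff_gf3_eq_zero_of_card_dbl` : a product `GF(P)·GF(A)·GF(B)` with `#a ≤ i` on `A` and `#b ≤ j` on `B` has zero coefficient at every profile with
  more than `i + j` doubled points;
* **`coeff_C2three_nonneg_of_four_le`**, **`coeff_Rt_three_C2_of_four_le`** : for `D = {#S < 3}` the subtracted block has zero coefficient at every
  profile with `≥ 4` doubled points off `v`, so the one-vertex monotonicity C2 of `R_3` holds at all such profiles (every pair of up-sets, every vertex).
With `…SahiCTCC2TopSlice` (tripled vertices) the level-3 conjecture C2 (memo g27 §4.2; ⇒ `R_3 ∈ ℕ[s]`) is reduced to the profiles with entries `≤ 2` and at most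
three doubled points off `v` (the "rows" 0–3 of the memo; row 3 is `…SahiCTCC2ThreeRowThree`).  Nothing is asserted about the crux.
-/

noncomputable section

open scoped Classical

namespace Summit.CriticalPhenomena.PercolationContinuityZ3.Theorems.SahiCTCForms

open Finset MvPolynomial SahiCTCGenFun

variable {α : Type*} [DecidableEq α] [Fintype α]

/-! ### Deletion and link of a filtered family -/

section Filters
variable (v : α) (K D : Finset (Finset α))

/-- The link of the members of `K` inside `D` is the part of the link of `K` inside the link of `D`. [this work] -/
theorem linkV_filter_mem_eq : linkV v (K.filter fun S => S ∈ D) = (linkV v K).filter fun S => S ∈ linkV v D := by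
  ext S; simp only [linkV, mem_filter, mem_powerset]; tauto

/-- The link of the members of `K` outside `D` is the part of the link of `K` outside the link of `D`. [this work] -/
theorem linkV_filter_not_mem_eq : linkV v (K.filter fun S => S ∉ D) = (linkV v K).filter fun S => S ∉ linkV v D := by
  ext S; simp only [linkV, mem_filter, mem_powerset]; tauto

omit [Fintype α] in
/-- The deletion of the members of `K` inside `D` is the part of the deletion of `K` inside the deletion of `D`. [this work] -/
theorem delV_filter_mem_eq : delV v (K.filter fun S => S ∈ D) = (delV v K).filter fun S => S ∈ delV v D := by
  ext S; simp only [delV, mem_filter]; tauto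

omit [Fintype α] in
/-- The deletion of the members of `K` outside `D` is the part of the deletion of `K` outside the deletion of `D`. [this work] -/
theorem delV_filter_not_mem_eq : delV v (K.filter fun S => S ∉ D) = (delV v K).filter fun S => S ∉ delV v D := by
  ext S; simp only [delV, mem_filter]; tauto

/-- `GF(linkV (K∖D)) = GF(linkV K) − GF(linkV (K∩D))`. [this work] -/
theorem gf_linkV_filter_not_mem : gf (linkV v (K.filter fun S => S ∉ D)) = gf (linkV v K) - gf (linkV v (K.filter fun S => S ∈ D)) := by
  rw [linkV_filter_not_mem_eq, linkV_filter_mem_eq, gf_eq_filter_mem_add_filter_not_mem (linkV v D) (linkV v K)]; ring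

omit [Fintype α] in
/-- `GF(delV (K∖D)) = GF(delV K) − GF(delV (K∩D))`. [this work] -/
theorem gf_delV_filter_not_mem : gf (delV v (K.filter fun S => S ∉ D)) = gf (delV v K) - gf (delV v (K.filter fun S => S ∈ D)) := by
  rw [delV_filter_not_mem_eq, delV_filter_mem_eq, gf_eq_filter_mem_add_filter_not_mem (delV v D) (delV v K)]; ring

end Filters

/-! ### The `v`-free Harris form of the C2 difference -/

section VfreeForm
variable (D F G : Finset (Finset α)) (v : α)

/-- **The C2 difference in `v`-free Harris form** (ring identity, any `D, 𝒳, 𝒵, v`):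
`P₂ − P₃ = GF(D¹)·(H_D + H_L + ΔΔ) + (GF(D⁰) − GF(D¹))·H_L + Π'·(pq' + p'q) − Π'·(GF(D⁰)·GF(linkV (C∩D)) + GF(D¹)·GF(delV (C∩D)))`. [this work] -/
theorem RlumpVx_two_sub_three_eq_vfree :
    RlumpVx D F G v 2 - RlumpVx D F G v 3 =
      gf (linkV v D) *
          ((gf (delV v (univ.powerset : Finset (Finset α))) * gf (delV v F ∩ delV v G) - gf (delV v F) * gf (delV v G))
            + (gf (delV v (univ.powerset : Finset (Finset α))) * gf (linkV v F ∩ linkV v G) - gf (linkV v F) * gf (linkV v G))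
            + (gf (linkV v F) - gf (delV v F)) * (gf (linkV v G) - gf (delV v G)))
      + (gf (delV v D) - gf (linkV v D)) *
          (gf (delV v (univ.powerset : Finset (Finset α))) * gf (linkV v F ∩ linkV v G) - gf (linkV v F) * gf (linkV v G))
      + gf (delV v (univ.powerset : Finset (Finset α)))
          * (gf (delV v (F.filter fun S => S ∈ D)) * gf (linkV v (G.filter fun S => S ∈ D))
            + gf (linkV v (F.filter fun S => S ∈ D)) * gf (delV v (G.filter fun S => S ∈ D)))
      - gf (delV v (univ.powerset : Finset (Finset α)))
          * (gf (delV v D) * gf (linkV v ((F ∩ G).filter fun S => S ∈ D)) + gf (linkV v D) * gf (delV v ((F ∩ G).filter fun S => S ∈ D))) := by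
  rw [RlumpVx_two_sub_three_eq_crossed, gf_linkV_filter_not_mem, gf_delV_filter_not_mem, linkV_inter, delV_inter]
  ring

end VfreeForm

/-! ### The coefficients of `H_D + H_L + ΔΔ` are Kleitman surpluses with `v` free -/

section HarrisVfree
variable {F G : Finset (Finset α)} {v : α}

omit [Fintype α] in
/-- The trace of a difference of families is the difference of the traces. [this work] -/
theorem tr_sdiff (A B : Finset (Finset α)) (D s : Finset α) : tr (A \ B) D s = tr A D s \ tr B D s := by
  ext U; simp only [mem_tr, mem_sdiff]; tauto

omit [Fintype α] in
/-- `GF(A) − GF(B) = GF(A ∖ B)` for `B ⊆ A`. [this work] -/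
theorem gf_sub_gf_eq_gf_sdiff {A B : Finset (Finset α)} (h : B ⊆ A) : gf A - gf B = gf (A \ B) := by
  have : gf A = gf B + gf (A \ B) := by rw [← gf_union disjoint_sdiff, union_sdiff_of_subset h]
  rw [this, add_sub_cancel_left]

/-- **The coefficient of `ΔΔ = (X¹−X⁰)(Z¹−Z⁰)` at a `v`-free profile `n ≤ 2` is the cross term of the vertex recursion of `kap` at `v`** on the
sub-cube `(dbl n, sgl n + v)`: the number of `U ⊆ sgl n` such that `v` is pivotal for `𝒳` at `dbl n ∪ U` and for `𝒵` at `dbl n ∪ (sgl n ∖ U)`. [this work] -/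
theorem coeff_deltaDelta_eq_card (hF : IsUpperSet (F : Set (Finset α))) (hG : IsUpperSet (G : Set (Finset α)))
    {n : α →₀ ℕ} (hn : ∀ i, n i ≤ 2) (hv : n v = 0) :
    ((gf (linkV v F) - gf (delV v F)) * (gf (linkV v G) - gf (delV v G))).coeff n =
      #((tr F (insert v (dbl n)) (sgl n) \ tr F (dbl n) (sgl n)).filter fun R =>
        sgl n \ R ∈ tr G (insert v (dbl n)) (sgl n) ∧ sgl n \ R ∉ tr G (dbl n) (sgl n)) := by
  obtain ⟨hD, hs⟩ := not_mem_dbl_sgl_of_apply_eq_zero hv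
  rw [gf_sub_gf_eq_gf_sdiff (delV_subset_linkV_of_isUpperSet hF), gf_sub_gf_eq_gf_sdiff (delV_subset_linkV_of_isUpperSet hG),
    coeff_gf_mul_gf_eq_card_tr _ _ hn, tr_sdiff, tr_sdiff, tr_linkV F hD hs, tr_delV F hD hs, tr_linkV G hD hs, tr_delV G hD hs]
  simp_rw [mem_sdiff]

/-- **`coeff_n (H_D + H_L + ΔΔ) = kap 𝒳 𝒵 (dbl n) (sgl n + v)`** at every `v`-free profile `n ≤ 2` (up-sets `𝒳, 𝒵`): the middle slice at `v` of the
plain Harris form has as coefficients the Kleitman surpluses of `𝒳, 𝒵` on the sub-cubes in which `v` is a FREE point (`…KleitmanSurplus.kap_rec`). [this work] -/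
theorem coeff_harrisVfree_eq_kap (hF : IsUpperSet (F : Set (Finset α))) (hG : IsUpperSet (G : Set (Finset α)))
    {n : α →₀ ℕ} (hn : ∀ i, n i ≤ 2) (hv : n v = 0) :
    ((gf (delV v (univ.powerset : Finset (Finset α))) * gf (delV v F ∩ delV v G) - gf (delV v F) * gf (delV v G))
      + (gf (delV v (univ.powerset : Finset (Finset α))) * gf (linkV v F ∩ linkV v G) - gf (linkV v F) * gf (linkV v G))
      + (gf (linkV v F) - gf (delV v F)) * (gf (linkV v G) - gf (delV v G))).coeff n
      = kap F G (dbl n) (insert v (sgl n)) := by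
  obtain ⟨hD, hs⟩ := not_mem_dbl_sgl_of_apply_eq_zero hv
  rw [coeff_add, coeff_add, coeff_harrisDel_eq_kap F G hn hv, coeff_harrisLink_eq_kap F G hn hv, coeff_deltaDelta_eq_card hF hG hn hv,
    kap_rec hF hG (mem_insert_self v (sgl n)) hD, erase_insert hs]

/-- The `v`-free Harris form `H_D + H_L + ΔΔ` has nonnegative coefficients. [this work] -/
theorem coeff_harrisVfree_nonneg (hF : IsUpperSet (F : Set (Finset α))) (hG : IsUpperSet (G : Set (Finset α))) (n : α →₀ ℕ) :
    0 ≤ ((gf (delV v (univ.powerset : Finset (Finset α))) * gf (delV v F ∩ delV v G) - gf (delV v F) * gf (delV v G))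
      + (gf (delV v (univ.powerset : Finset (Finset α))) * gf (linkV v F ∩ linkV v G) - gf (linkV v F) * gf (linkV v G))
      + (gf (linkV v F) - gf (delV v F)) * (gf (linkV v G) - gf (delV v G))).coeff n := by
  rw [coeff_add, coeff_add]
  refine add_nonneg (add_nonneg (coeff_harrisDel_nonneg hF hG n) (coeff_harrisLink_nonneg hF hG n)) ?_
  exact coeff_mul_nonneg (coeff_gf_sub_gf_nonneg (delV_subset_linkV_of_isUpperSet hF))
    (coeff_gf_sub_gf_nonneg (delV_subset_linkV_of_isUpperSet hG)) n

end HarrisVfree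

/-! ### Triple products of families of small sets vanish at profiles with many doubled points -/

omit [Fintype α] in
/-- If `1_S + 1_a + 1_b = m` then every doubled point of `m` lies in `a ∪ b`. [this work] -/
theorem dbl_subset_union_of_ind_add {S a b : Finset α} {m : α →₀ ℕ} (h : ind S + (ind a + ind b) = m) : dbl m ⊆ a ∪ b := by
  intro x hx
  have hx2 : m x = 2 := (mem_filter.1 hx).2
  have hsum := congrArg (fun f => f x) h
  simp only [Finsupp.add_apply, ind_apply] at hsum
  rw [mem_union]
  by_contra hnot
  rw [not_or] at hnot
  rw [if_neg hnot.1, if_neg hnot.2] at hsum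
  split_ifs at hsum <;> omega

omit [Fintype α] in
/-- **A product `GF(P)·(GF(A)·GF(B))` with `#a ≤ i` on `A` and `#b ≤ j` on `B` has zero coefficient at every profile with more than `i + j` doubled
points** (the doubled points of `1_S + 1_a + 1_b` lie in `a ∪ b`). [this work] -/
theorem coeff_gf3_eq_zero_of_card_dbl (P A B : Finset (Finset α)) {i j : ℕ} (hA : ∀ a ∈ A, #a ≤ i) (hB : ∀ b ∈ B, #b ≤ j)
    {m : α →₀ ℕ} (hm : i + j < #(dbl m)) : (gf P * (gf A * gf B)).coeff m = 0 := by
  rw [coeff_gf_mul]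
  refine sum_eq_zero fun S hS => ?_
  rw [coeff_gf_mul_gf, Nat.cast_eq_zero, card_eq_zero, filter_eq_empty_iff]
  intro ab hab hind
  obtain ⟨ha, hb⟩ := mem_product.1 hab
  have hle := (mem_filter.1 hS).2
  have hsum : ind S + (ind ab.1 + ind ab.2) = m := by rw [hind, add_tsub_cancel_of_le hle]
  have hsub := dbl_subset_union_of_ind_add hsum
  have h1 := card_le_card hsub
  have h2 := card_union_le ab.1 ab.2
  have h3 := hA _ ha
  have h4 := hB _ hb
  omega

/-! ### C2 at level `3` at profiles with `≥ 4` doubled points -/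

section LevelThree
variable {F G : Finset (Finset α)} {v : α}

/-- Members of the deletion of `{#S < 3}` have at most two elements. [this work] -/
theorem card_le_two_of_mem_delV_bySize {S : Finset α} (h : S ∈ delV v (bySize (· < 3) : Finset (Finset α))) : #S ≤ 2 := by
  have := (mem_bySize_iff _ _).1 (mem_filter.1 h).1; omega

/-- Members of the link of `{#S < 3}` have at most one element. [this work] -/
theorem card_le_one_of_mem_linkV_bySize {S : Finset α} (h : S ∈ linkV v (bySize (· < 3) : Finset (Finset α))) : #S ≤ 1 := by
  have hS := mem_filter.1 h
  have hv : v ∉ S := not_mem_of_mem_linkV h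
  have h3 := (mem_bySize_iff _ _).1 hS.2
  rw [card_insert_of_notMem hv] at h3; omega

/-- Members of the link of the common members inside `{#S < 3}` have at most one element. [this work] -/
theorem card_le_one_of_mem_linkV_filter {S : Finset α}
    (h : S ∈ linkV v ((F ∩ G).filter fun S => S ∈ (bySize (· < 3) : Finset (Finset α)))) : #S ≤ 1 := by
  rw [linkV_filter_mem_eq] at h
  exact card_le_one_of_mem_linkV_bySize (mem_filter.1 h).2

omit [Fintype α] in
/-- Members of the deletion of the common members inside `{#S < 3}` have at most two elements. [this work] -/
theorem card_le_two_of_mem_delV_filter [Fintype α] {S : Finset α}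
    (h : S ∈ delV v ((F ∩ G).filter fun S => S ∈ (bySize (· < 3) : Finset (Finset α)))) : #S ≤ 2 := by
  rw [delV_filter_mem_eq] at h
  exact card_le_two_of_mem_delV_bySize (mem_filter.1 h).2

/-- **The subtracted block of the level-3 C2 difference vanishes at every `v`-free profile with `≥ 4` doubled points.** [this work] -/
theorem coeff_smallBlock_eq_zero_of_four_le {m : α →₀ ℕ} (hm : 4 ≤ #(dbl m)) :
    (gf (delV v (univ.powerset : Finset (Finset α)))
      * (gf (delV v (bySize (· < 3) : Finset (Finset α))) * gf (linkV v ((F ∩ G).filter fun S => S ∈ (bySize (· < 3) : Finset (Finset α))))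
        + gf (linkV v (bySize (· < 3) : Finset (Finset α))) * gf (delV v ((F ∩ G).filter fun S => S ∈ (bySize (· < 3) : Finset (Finset α)))))).coeff m
      = 0 := by
  rw [mul_add, coeff_add,
    coeff_gf3_eq_zero_of_card_dbl _ _ _ (fun a ha => card_le_two_of_mem_delV_bySize ha) (fun b hb => card_le_one_of_mem_linkV_filter hb) (by omega),
    coeff_gf3_eq_zero_of_card_dbl _ _ _ (fun a ha => card_le_one_of_mem_linkV_bySize ha) (fun b hb => card_le_two_of_mem_delV_filter hb) (by omega),
    add_zero]

/-- **C2 of `R_3` at a vertex, in crossed form, at every `v`-free profile with `≥ 4` doubled points**: the coefficient of `P₂ − P₃` is `≥ 0`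
(the three Harris-type blocks are `≥ 0` coefficientwise and the subtracted block vanishes). [this work] -/
theorem coeff_C2three_nonneg_of_four_le (hF : IsUpperSet (F : Set (Finset α))) (hG : IsUpperSet (G : Set (Finset α))) (v : α)
    {m : α →₀ ℕ} (hm : 4 ≤ #(dbl m)) :
    0 ≤ (RlumpVx (bySize (· < 3)) F G v 2 - RlumpVx (bySize (· < 3)) F G v 3).coeff m := by
  rw [RlumpVx_two_sub_three_eq_vfree, coeff_sub, coeff_add, coeff_add, coeff_smallBlock_eq_zero_of_four_le hm, sub_zero]
  have hnn : ∀ K : Finset (Finset α), ∀ n, 0 ≤ (gf K).coeff n := fun K n => coeff_gf_nonneg K n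
  refine add_nonneg (add_nonneg ?_ ?_) ?_
  · exact coeff_mul_nonneg (hnn _) (coeff_harrisVfree_nonneg hF hG) m
  · exact coeff_mul_nonneg (coeff_gf_sub_gf_nonneg (linkV_subset_delV_of_isLowerSet (isLowerSet_bySize_lt 3)))
      (coeff_harrisLink_nonneg hF hG) m
  · refine coeff_mul_nonneg (hnn _) (fun n => ?_) m
    rw [coeff_add]
    exact add_nonneg (coeff_mul_nonneg (hnn _) (hnn _) n) (coeff_mul_nonneg (hnn _) (hnn _) n)

omit [Fintype α] in
/-- Removing `2e_v` from a profile with `m_v = 2` removes `v` from the doubled set. [this work] -/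
theorem dbl_tsub_single_two {m : α →₀ ℕ} (hv : m v = 2) : dbl (m - Finsupp.single v 2) = (dbl m).erase v := by
  ext w
  simp only [dbl, mem_filter, Finsupp.mem_support_iff, mem_erase, Finsupp.tsub_apply, Finsupp.single_apply]
  by_cases h : v = w
  · subst h; simp [hv]
  · simp [h, Ne.symm h]

/-- **C2 OF `R_3` HOLDS AT EVERY PROFILE WITH `≥ 4` DOUBLED POINTS OFF THE VERTEX**: for up-sets `𝒳, 𝒵`, a vertex `v` and a profile `m` with
`m_v = 2` and at least four further entries equal to `2`, `coeff_{m+e_v} R_3(𝒳,𝒵) ≤ coeff_m R_3(𝒳,𝒵)`. [this work] -/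
theorem coeff_Rt_three_C2_of_four_le (hF : IsUpperSet (F : Set (Finset α))) (hG : IsUpperSet (G : Set (Finset α)))
    (m : α →₀ ℕ) (v : α) (hv : m v = 2) (h4 : 4 ≤ #((dbl m).erase v)) :
    (Rt 3 F G).coeff (m + Finsupp.single v 1) ≤ (Rt 3 F G).coeff m := by
  set m₀ := m - Finsupp.single v 2 with hm₀
  have hm₀v : m₀ v = 0 := by rw [hm₀, Finsupp.tsub_apply, Finsupp.single_eq_same, hv]
  have hm_eq : m = m₀ + Finsupp.single v 2 := by
    rw [hm₀, tsub_add_cancel_of_le]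
    rw [Finsupp.single_le_iff, hv]
  have h3 : m + Finsupp.single v 1 = m₀ + Finsupp.single v 3 := by
    rw [hm_eq, add_assoc, ← Finsupp.single_add]
  have hd : 4 ≤ #(dbl m₀) := by rw [hm₀, dbl_tsub_single_two hv]; exact h4
  rw [h3, hm_eq, Rt_eq_Rlump, coeff_Rlump_add_single _ F G v hm₀v (by norm_num),
    coeff_Rlump_add_single _ F G v hm₀v (by norm_num), ← sub_nonneg, ← coeff_sub]
  exact coeff_C2three_nonneg_of_four_le hF hG v hd

end LevelThree

end Summit.CriticalPhenomena.PercolationContinuityZ3.Theorems.SahiCTCForms
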